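import Mathlib
import Summits.ValiantsHypothesis.ValiantsHypothesis.Theses.FreeFermionCLL
import Summits.ValiantsHypothesis.ValiantsHypothesis.Theorems.FreeFermionCLLExpImpliesGap

/-!
# Birth skeleton (BC3) for split piece `FreeFermionQPDecay` of `PMCorrelationGap` — the FEKETE LINE

Piece (child 1 of the glued split `FreeFermionQPDecay → ColourMerging → PMCorrelationGap`,
crux-strategist seat `planner-cstrat-stmt-ValiantsHypothesis-13555-r1-0`): for every `c`, eventually
in `n`, every read-once kernel `K ∈ ℂ^(n²×n²)` has
`2^((log₂ n + c)^c)·‖permMass(FF_K^(n))‖² ≤ n!·coeffNormSq(FF_K^(n))`.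

Line: with `s(n) := sup_K permCorrSq(FF_K^(n))` (the free-fermion overlap at level `n`),
* `stub_subMult` — SUB-MULTIPLICATIVITY over board sizes: every kernel on the `(n+m)`-board has
  overlap `≤ s(n)·s(m)` (the route's foreseen `FidelityMultiplicative`, Gaussian-extent style;
  block-diagonal kernels give `≤ s(n)s(m)·n!m!/(n+m)!`, the content is the coupled kernels);
* `stub_thresholdHalf` — ONE FINITE LEVEL `n₀ ≥ 1` with `s(n₀) ≤ 1/2` (a finite, in principle
  certifiable statement; by the numerics on items 13556/13563, `n₀ ≥ 6`);
* `FreeFermionQPDecay_of` — Fekete: `s(n) ≤ s(n₀)^⌊n/n₀⌋ ≤ 2^-⌊n/n₀⌋`, and `⌊n/n₀⌋ ≥ (log₂ n + c)^c`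
  eventually (`tendsto_natLog_add_pow_div_atTop`), so `permCorrSq ≤ 2^-((log₂ n + c)^c)`, which is the
  piece in division-free form (`permCorrSq_le_iff`).  PROVED below (no sorry outside the stubs).

Both stubs are genuine (`stub_subMult` is the hardest: no restriction lemma linking `per_(n+m)` to
block targets is known; `stub_thresholdHalf` is open numerically beyond `n = 5`); neither is the
piece, the parent or the summit (probes in the seat folder `bc/`).
-/

set_option linter.dupNamespace false

namespace Summit.ValiantsHypothesis.ValiantsHypothesis.Theses.FreeFermionCLL

/-- The piece, verbatim as the split renders it (child 1 of `PMCorrelationGap`). Once the split is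
enacted this local copy is replaced by the route-file decl of the same name. -/
def FreeFermionQPDecay : Prop :=
  ∀ c : ℕ, ∃ n₀ : ℕ, ∀ n ≥ n₀, ∀ (K : Matrix (Fin n × Fin n) (Fin n × Fin n) ℂ), (2 : ℝ) ^ ((Nat.log 2 n + c) ^ c) * ‖Literature.Computability.AlgebraicComplexity.permMass n (MvPolynomial.homogeneousComponent n (1 + Matrix.diagonal (fun e : Fin n × Fin n => MvPolynomial.X e) * K.map (fun a : ℂ => (MvPolynomial.C a : MvPolynomial (Fin n × Fin n) ℂ))).det)‖ ^ 2 ≤ (n.factorial : ℝ) * Literature.Computability.AlgebraicComplexity.coeffNormSq n (MvPolynomial.homogeneousComponent n (1 + Matrix.diagonal (fun e : Fin n × Fin n => MvPolynomial.X e) * K.map (fun a : ℂ => (MvPolynomial.C a : MvPolynomial (Fin n × Fin n) ℂ))).det)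

end Summit.ValiantsHypothesis.ValiantsHypothesis.Theses.FreeFermionCLL

namespace Summit.ValiantsHypothesis.ValiantsHypothesis.Cruxes.PMCorrelationGap.FeketeLine

open Filter Topology
open Literature.Computability.AlgebraicComplexity
open Summit.ValiantsHypothesis.ValiantsHypothesis.Theses.FreeFermionCLL

/-- The degree-`n` component of the read-once (free-fermion) form with kernel `K` on the `n × n` board. -/
local notation "FF(" n ", " K ")" =>
  MvPolynomial.homogeneousComponent n
    (Matrix.det (1 + Matrix.diagonal (fun e : Fin n × Fin n => MvPolynomial.X e) *
      Matrix.map K (fun a : ℂ => (MvPolynomial.C a : MvPolynomial (Fin n × Fin n) ℂ))))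

/-- The free-fermion overlap `s(n) = sup_K permCorrSq(FF_K^(n))`. -/
local notation "ffSup(" n ")" =>
  ⨆ K : Matrix (Fin n × Fin n) (Fin n × Fin n) ℂ, permCorrSq n (FF(n, K))

/-- **stub (hardest, size L)** — sub-multiplicativity of the free-fermion overlap over board sizes. -/
theorem stub_subMult :
    ∀ (n m : ℕ) (K : Matrix (Fin (n + m) × Fin (n + m)) (Fin (n + m) × Fin (n + m)) ℂ),
      permCorrSq (n + m) (FF(n + m, K)) ≤ ffSup(n) * ffSup(m) := by
  sorry

/-- **stub (size M, computational)** — one finite level at which free fermions are at angle ≥ 45°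
from the bosons. -/
theorem stub_thresholdHalf : ∃ n₀ : ℕ, 1 ≤ n₀ ∧ ffSup(n₀) ≤ 1 / 2 := by
  sorry

/-- Every overlap is bounded by the level's supremum. -/
theorem le_ffSup (n : ℕ) (K : Matrix (Fin n × Fin n) (Fin n × Fin n) ℂ) :
    permCorrSq n (FF(n, K)) ≤ ffSup(n) :=
  le_ciSup (f := fun K : Matrix (Fin n × Fin n) (Fin n × Fin n) ℂ => permCorrSq n (FF(n, K)))
    ⟨1, by rintro _ ⟨K', rfl⟩; exact permCorrSq_le_one _⟩ K

theorem ffSup_nonneg (n : ℕ) : 0 ≤ ffSup(n) :=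
  Real.iSup_nonneg fun _ => permCorrSq_nonneg _

theorem ffSup_le_one (n : ℕ) : ffSup(n) ≤ 1 :=
  Real.iSup_le (fun _ => permCorrSq_le_one _) zero_le_one

/-- **Composition (Fekete)**: the two stubs imply the piece. -/
theorem FreeFermionQPDecay_of
    (h₁ : ∀ (n m : ℕ) (K : Matrix (Fin (n + m) × Fin (n + m)) (Fin (n + m) × Fin (n + m)) ℂ),
      permCorrSq (n + m) (FF(n + m, K)) ≤ ffSup(n) * ffSup(m))
    (h₂ : ∃ n₀ : ℕ, 1 ≤ n₀ ∧ ffSup(n₀) ≤ 1 / 2) :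
    FreeFermionQPDecay := by
  obtain ⟨n₀, hn₀, hhalf⟩ := h₂
  -- the overlap function and its basic properties
  set s : ℕ → ℝ := fun k => ffSup(k) with hs
  have hs0 : ∀ k, 0 ≤ s k := fun k => ffSup_nonneg k
  have hs1 : ∀ k, s k ≤ 1 := fun k => ffSup_le_one k
  have hsub : ∀ k j, s (k + j) ≤ s k * s j := fun k j =>
    Real.iSup_le (fun K => h₁ k j K) (mul_nonneg (hs0 k) (hs0 j))
  -- Fekete: `s (n₀ q) ≤ (1/2)^q`
  have hblock : ∀ q : ℕ, s (n₀ * q) ≤ (1 / 2) ^ q := by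
    intro q
    induction q with
    | zero => simpa using hs1 0
    | succ q ih =>
        calc s (n₀ * (q + 1)) = s (n₀ * q + n₀) := by rw [Nat.mul_succ]
          _ ≤ s (n₀ * q) * s n₀ := hsub _ _
          _ ≤ (1 / 2) ^ q * (1 / 2) :=
              mul_le_mul ih hhalf (hs0 _) (pow_nonneg (by norm_num) _)
          _ = (1 / 2) ^ (q + 1) := (pow_succ _ _).symm
  have hdiv : ∀ n : ℕ, s n ≤ (1 / 2) ^ (n / n₀) := by
    intro n
    have h := hsub (n₀ * (n / n₀)) (n % n₀)
    rw [Nat.div_add_mod] at h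
    calc s n ≤ s (n₀ * (n / n₀)) * s (n % n₀) := h
      _ ≤ (1 / 2) ^ (n / n₀) * 1 :=
          mul_le_mul (hblock _) (hs1 _) (hs0 _) (pow_nonneg (by norm_num) _)
      _ = (1 / 2) ^ (n / n₀) := mul_one _
  -- `(log₂ n + c)^c ≤ n / n₀` eventually
  intro c
  have hn₀pos : (0 : ℝ) < n₀ := by exact_mod_cast hn₀
  have hev : ∀ᶠ n : ℕ in atTop,
      (((Nat.log 2 n + c) ^ c : ℕ) : ℝ) / (n : ℝ) < 1 / (2 * n₀) :=
    (Theorems.FreeFermionCLL.tendsto_natLog_add_pow_div_atTop c).eventually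
      (gt_mem_nhds (by positivity))
  obtain ⟨N₁, hN₁⟩ := eventually_atTop.1 hev
  refine ⟨max N₁ 1, fun n hn K => ?_⟩
  have hnN : N₁ ≤ n := le_trans (le_max_left _ _) hn
  have hn1 : 1 ≤ n := le_trans (le_max_right _ _) hn
  set a : ℕ := (Nat.log 2 n + c) ^ c with ha
  -- from `a/n < 1/(2 n₀)` and `n ≥ 1`: `a * n₀ ≤ n`, hence `a ≤ n / n₀`
  have hlt := hN₁ n hnN
  have hnpos : (0 : ℝ) < n := by exact_mod_cast hn1
  have hreal : (a : ℝ) * n₀ ≤ n := by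
    rw [div_lt_div_iff₀ hnpos (by positivity)] at hlt
    nlinarith [hlt]
  have hnat : a * n₀ ≤ n := by exact_mod_cast hreal
  have haq : a ≤ n / n₀ := (Nat.le_div_iff_mul_le hn₀).2 hnat
  -- `permCorrSq ≤ s n ≤ (1/2)^(n/n₀) ≤ (1/2)^a = (2^a)⁻¹`
  have hcorr : permCorrSq n (FF(n, K)) ≤ ((2 : ℝ) ^ a)⁻¹ := by
    calc permCorrSq n (FF(n, K)) ≤ s n := le_ffSup n K
      _ ≤ (1 / 2) ^ (n / n₀) := hdiv n
      _ ≤ (1 / 2) ^ a := pow_le_pow_of_le_one (by norm_num) (by norm_num) haq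
      _ = ((2 : ℝ) ^ a)⁻¹ := by rw [one_div, inv_pow]
  have h2a : (0 : ℝ) < (2 : ℝ) ^ a := pow_pos two_pos _
  rw [permCorrSq_le_iff (inv_nonneg.2 h2a.le), inv_mul_eq_div, le_div_iff₀ h2a] at hcorr
  calc (2 : ℝ) ^ a * ‖permMass n (FF(n, K))‖ ^ 2 = ‖permMass n (FF(n, K))‖ ^ 2 * 2 ^ a := mul_comm _ _
    _ ≤ (n.factorial : ℝ) * coeffNormSq n (FF(n, K)) := hcorr

end Summit.ValiantsHypothesis.ValiantsHypothesis.Cruxes.PMCorrelationGap.FeketeLine
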